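import Summits.NavierStokesRegularity.NavierStokesRegularity.Theorems.ScaledTopAlignmentExistsAnchorGlueKit
import HarnessLib
/-!
# Route `ScaledTopAlignment`: the TYPE-I BLOW-UP PORTRAIT forced by the re-anchored kit — at a Type-I singular
# time, near-maximum vorticity windows misaligned against EVERY direction recur on time sets of full upper
# density (support for the deciding crux W3ᵐᵗ = `AprioriMostTimesBulkAlignment`, stmt-NavierStokesRegularity-19551,
# and the banked re-anchored door W3ᵐᵗ-∃e; no import of the route file)

Contrapositive, positive reading of `false_of_mostTimesBulkAlignedExistsAnchor_typeI`
(`ScaledTopAlignmentExistsAnchorGlueKit`): let `(u, p)` be a classical solution of the Navier–Stokes system on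
`ℝ³ × [0, T)` (`ν > 0`, no force), Leray–Hopf from a rapidly decaying datum, with the Type-I rate at `T` and NOT
extending classically past `T`. Then for EVERY comparability ratio `λ₀ < 1`, window radius `R₀ > 0` and density
fraction `θ < 1` there are `κ, ε, δ > 0` such that for every level `M` and EVERY candidate exceptional time set `E`
of final density `≤ θ` at `T`, some time `t ∈ [0,T) ∖ E` carries a point `x` with `|ω(t,x)| ≥ M`,
`|ω(t,x)| ≥ κ/(T − t)` whose window `|x − y| ≤ R₀ℓ`, `ℓ = √(ν/|ω(t,x)|)`, contains, for EVERY unit vector `e`,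
an `ε`-misaligned-against-`e` part of the relative `λ₀`-top set of volume `> δℓ³`
(`omnidirectionally_misaligned_nearMax_windows_of_typeI_blowup`). Compared with p5's portrait
(`persistent_misaligned_nearMax_windows_of_typeI_blowup`: misalignment against the local direction `ξ(t,x)`, at
all late times) the misalignment here defeats EVERY single direction — the comparable-amplitude bulk near the
maximum is not captured by any one unit vector — on time sets that no set of final density `< 1` can avoid.
WHAT THIS IS NOT: not NS regularity and not a blow-up construction — a necessary condition on hypothetical Type-I
singularities, kernel-checked. References: Giga–Miura, CMP 303 (2011) = HUPS #956, Thm 1.1, §2.1 [GigaMiura2011];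
KNSS, Acta Math. 203 (2009) §6 [KochNadirashviliSereginSverak2009].
-/

noncomputable section
-- the summit and its single sub-problem share the name (CONVENTIONS §1), as in every Theorems file
set_option linter.dupNamespace false
open MeasureTheory Set Function Filter Topology Metric
open scoped RealInnerProductSpace ENNReal
namespace Summit.NavierStokesRegularity.NavierStokesRegularity.Theorems
open Literature.Analysis Literature.Analysis.FluidPDE

/-- **Type-I blow-up portrait, re-anchored form: near-maximum windows misaligned against every direction, on
time sets of full upper density.** For `ν > 0`, `T > 0`, a classical solution `(u, p)` on `ℝ³ × [0, T)`,
Leray–Hopf from its rapidly decaying datum `u 0`, with the Type-I rate at `T` and no smooth extension past `T`,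
and for every `λ₀ < 1`, `R₀ > 0`, `θ < 1`: there are `κ, ε, δ > 0` such that for every `M > 0` and every time set
`E` of final density `≤ θ` at `T`, some `t ∈ [0,T) ∖ E` and some `x` satisfy `|ω(t,x)| ≥ M`,
`|ω(t,x)| ≥ κ/(T−t)`, and for EVERY unit vector `e` the `ε`-misaligned-against-`e` part of
`{ |ω(t,·)| ≥ λ₀|ω(t,x)| } ∩ B(x, R₀ℓ)` has volume `> δ ℓ³` (`ℓ = √(ν/|ω(t,x)|)`). Contrapositive of
`false_of_mostTimesBulkAlignedExistsAnchor_typeI` (slab bounds from `liouvilleKillsTypeI_exists_bound_Icc`).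
[cite: GigaMiura2011, Thm 1.1 with Rmk 1.4 and §2.1 (HUPS preprint #956 pp. 3–9)] -/
theorem omnidirectionally_misaligned_nearMax_windows_of_typeI_blowup {ν T : ℝ} (hν : 0 < ν) (hT : 0 < T)
    {u : ℝ → EuclideanSpace ℝ (Fin 3) → EuclideanSpace ℝ (Fin 3)} {p : ℝ → EuclideanSpace ℝ (Fin 3) → ℝ}
    (hsol : IsClassicalNSSolutionOn (Ico 0 T) ν 0 u p) (hLH : IsLerayHopfOn T ν 0 (u 0) u)
    (hdec : HasRapidSpatialDecay (u 0)) (hI : IsTypeIBlowup u T) (hext : ¬ HasSmoothExtensionPast ν 0 u T)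
    {lam0 R0 θ : ℝ} (hlam01 : lam0 < 1) (hR0 : 0 < R0) (hθ : θ < 1) :
    ∃ κ : ℝ, 0 < κ ∧ ∃ ε : ℝ, 0 < ε ∧ ∃ δ : ℝ, 0 < δ ∧ ∀ M : ℝ, 0 < M → ∀ E : Set ℝ,
      (∃ h0 : ℝ, 0 < h0 ∧ ∀ h : ℝ, 0 < h → h < h0 →
        volume (E ∩ Set.Ioo (T - h) T) ≤ ENNReal.ofReal (θ * h)) →
      ∃ t ∈ Set.Ico 0 T, t ∉ E ∧ ∃ x : EuclideanSpace ℝ (Fin 3),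
        M ≤ ‖curl (u t) x‖ ∧ κ / (T - t) ≤ ‖curl (u t) x‖ ∧
        ∀ e : EuclideanSpace ℝ (Fin 3), ‖e‖ = 1 →
          ENNReal.ofReal (δ * Real.sqrt (ν / ‖curl (u t) x‖) ^ 3) <
            volume {y : EuclideanSpace ℝ (Fin 3) | lam0 * ‖curl (u t) x‖ ≤ ‖curl (u t) y‖ ∧
                ‖x - y‖ ≤ R0 * Real.sqrt (ν / ‖curl (u t) x‖) ∧
                ε < Real.sqrt (1 - (inner ℝ e (‖curl (u t) y‖⁻¹ • curl (u t) y)) ^ 2)} := by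
  by_contra hno
  push Not at hno
  -- slab bounds on closed sub-strips
  have hslab : ∀ T' < T, ∃ M : ℝ, ∀ s ∈ Set.Icc 0 T', ∀ x, ‖u s x‖ ≤ M := by
    intro T' hT'
    by_cases h : 0 < T'
    · exact liouvilleKillsTypeI_exists_bound_Icc hν hsol hLH hdec ⟨h, hT'⟩
    · obtain ⟨M, hM⟩ := liouvilleKillsTypeI_exists_bound_Icc hν hsol hLH hdec (T' := T / 2)
        ⟨by linarith, by linarith⟩
      push Not at h
      exact ⟨M, fun s hs x => hM s ⟨hs.1, by linarith [hs.2]⟩ x⟩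
  refine false_of_mostTimesBulkAlignedExistsAnchor_typeI hν hT hsol hLH hslab hI hext hlam01 hR0 hθ
    fun κ hκ ε hε δ hδ => ?_
  obtain ⟨M, hM, E, hE, hrest⟩ := hno κ hκ ε hε δ hδ
  refine ⟨M, hM, E, hE, fun t ht htE x hMx hκx => ?_⟩
  obtain ⟨e, he1, hvol⟩ := hrest t ht htE x hMx hκx
  exact ⟨e, he1, hvol⟩

end Summit.NavierStokesRegularity.NavierStokesRegularity.Theorems
end
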